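import Literature.Combinatorics.Enumerative.StirlingLucasCongruenceExplicit
import Literature.Combinatorics.Enumerative.StirlingNumbersParity
import Mathlib
import HarnessLib

/-!
# Three worked congruences: the parity of `[180 70]` and `C(180,70)`, and `[1567 789]` modulo `7` (Mező 2020, Chapter 11 Exercises 1–3)

I. Mező, *Combinatorics and Number Theory of Counting Sequences* (CRC Press, 2020), Chapter 11 «Congruences», Exercises
1–3 (p. 326).  Source (VERBATIM, held text `book:mezond-combinatorics-number-theory-counting-sequences`, OCR chunk
p0221):

> 1. Is `[180 70]` even or odd?
> 2. Is `C(180, 70)` even or odd?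
> 3. Determine `[1567 789]` modulo `7`.

## Answers and roads (the book prints no solutions)

1. **Even**: by §11.4 every `[n k]` with `k < ⌈n/2⌉` is even (tree `StirlingNumbersParity.even_stirlingFirst_of_lt`),
   and `70 < 90 = ⌈180/2⌉`.
2. **Even**: by Lucas' congruence (§11.3; Mathlib `Choose.choose_modEq_choose_mod_mul_choose_div_nat`) applied twice,
   `C(180,70) ≡ C(0,0)·C(90,35) ≡ C(0,0)·C(0,1)·C(45,17) = 0 (mod 2)` (in binary `70 = 1000110₂` has the bit `2⁶`
   that `180 = 10110100₂` lacks).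
3. **`[1567 789] ≡ 0 (mod 7)`**: `1567 = 223·7 + 6` and `789 = 223 + 94·(7−1) + 2`, so by the explicit Lucas
   congruence (11.24) for the first kind (tree `StirlingLucasCongruenceExplicit.stirlingFirst_cast_zmod_lucas`)
   `[1567 789] ≡ (−1)^{223−94} C(223, 94) [6 2] (mod 7)`, and `C(223,94) ≡ C(6,3)·C(31,13) ≡ C(6,3)·C(3,6)·C(4,1) = 0
   (mod 7)` by Lucas' congruence (`223 = 436₇`, `94 = 163₇`: the digit `6 > 3`).  (`[6 2] = 274`.)

All three answers were re-checked numerically (the Stirling triangle reduced mod `2`, resp. mod `7`, row by row).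

## What is formalised (all proved)

`even_stirlingFirst_180_70` (Exercise 1), `choose_180_70_modEq_zero`, `even_choose_180_70` (Exercise 2),
`choose_223_94_modEq_zero`, **`stirlingFirst_1567_789_modEq_zero`** (Exercise 3), `stirlingFirst_six_two`.

## References
* [Mezo2020] I. Mező, *Combinatorics and Number Theory of Counting Sequences*, CRC Press (2020), Chapter 11 Exercises
  1–3, p. 326 (with §11.3 Lucas' congruence and §11.4, §11.6.1 (11.24)).
-/

namespace Literature.Combinatorics.Enumerative.LucasCongruenceWorkedExercises

open Nat
open StirlingNumbersParity (even_stirlingFirst_of_lt)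
open StirlingLucasCongruenceExplicit (stirlingFirst_cast_zmod_lucas)

/-! ## Exercise 1 -/

/-- **Exercise 1**: `[180 70]` is even (`70 < ⌈180/2⌉ = 90`). [cite: Mezo2020, Chapter 11 Exercise 1, p. 326] -/
theorem even_stirlingFirst_180_70 : Even (Nat.stirlingFirst 180 70) :=
  even_stirlingFirst_of_lt (by norm_num)

/-! ## Exercise 2 -/

/-- **Exercise 2**: `C(180,70) ≡ 0 (mod 2)` by two Lucas steps. [cite: Mezo2020, Chapter 11 Exercise 2, p. 326] -/
theorem choose_180_70_modEq_zero : Nat.choose 180 70 ≡ 0 [MOD 2] := by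
  haveI := Fact.mk Nat.prime_two
  have h1 := Choose.choose_modEq_choose_mod_mul_choose_div_nat (n := 180) (k := 70) (p := 2)
  have h2 := Choose.choose_modEq_choose_mod_mul_choose_div_nat (n := 90) (k := 35) (p := 2)
  norm_num at h1 h2
  exact h1.trans h2

/-- **Exercise 2**: `C(180,70)` is even. [cite: Mezo2020, Chapter 11 Exercise 2, p. 326] -/
theorem even_choose_180_70 : Even (Nat.choose 180 70) :=
  Nat.even_iff.2 choose_180_70_modEq_zero

/-! ## Exercise 3 -/

/-- `C(223,94) ≡ 0 (mod 7)` (Lucas: `223 = 436₇`, `94 = 163₇`). [cite: Mezo2020, Chapter 11 Exercise 3 with §11.3, p. 326] -/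
theorem choose_223_94_modEq_zero : Nat.choose 223 94 ≡ 0 [MOD 7] := by
  haveI := Fact.mk (by norm_num : Nat.Prime 7)
  have h2 : Nat.choose 31 13 ≡ 0 [MOD 7] := by
    have h := Choose.choose_modEq_choose_mod_mul_choose_div_nat (n := 31) (k := 13) (p := 7)
    norm_num at h
    -- h : C(31,13) ≡ C(3,6) * 4 [MOD 7]
    rwa [show Nat.choose 3 6 = 0 by decide, zero_mul] at h
  have h1 := Choose.choose_modEq_choose_mod_mul_choose_div_nat (n := 223) (k := 94) (p := 7)
  norm_num at h1
  -- h1 : C(223,94) ≡ C(6,3) * C(31,13) [MOD 7]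
  exact h1.trans (by simpa using h2.mul_left (Nat.choose 6 3))

/-- `[6 2] = 274`. [cite: Mezo2020, Chapter 11 Exercise 3 (the value needed), p. 326] -/
theorem stirlingFirst_six_two : Nat.stirlingFirst 6 2 = 274 := by
  decide

/-- **Exercise 3**: `[1567 789] ≡ 0 (mod 7)` — `1567 = 223·7 + 6`, `789 = 223 + 94·6 + 2`, so by (11.24)
`[1567 789] ≡ (−1)^{129} C(223,94) [6 2] ≡ 0` since `7 ∣ C(223,94)`. [cite: Mezo2020, Chapter 11 Exercise 3, p. 326] -/
theorem stirlingFirst_1567_789_modEq_zero : Nat.stirlingFirst 1567 789 ≡ 0 [MOD 7] := by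
  have hp : Nat.Prime 7 := by norm_num
  haveI := Fact.mk hp
  rw [← ZMod.natCast_eq_natCast_iff, Nat.cast_zero, show 1567 = 223 * 7 + 6 by norm_num,
    show 789 = 223 + 94 * (7 - 1) + 2 by norm_num,
    stirlingFirst_cast_zmod_lucas hp (by norm_num) (by norm_num) (by norm_num) (by norm_num),
    (ZMod.natCast_eq_zero_iff _ _).2 ((Nat.modEq_zero_iff_dvd).1 choose_223_94_modEq_zero), mul_zero, zero_mul]

end Literature.Combinatorics.Enumerative.LucasCongruenceWorkedExercises
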